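import Summits.HubbardSuperconductivity.HubbardLadder.R3R4Props
import HarnessLib

/-!
# Finite torus: the translation-averaged `d`-wave pair correlator is dominated by its diagonal value, for EVERY state — one certified diagonal ceiling boxes every displacement

HONEST FRAMING: first certified bounds; not a superconductivity verdict; every number certified or labelled float.
Speedrun `mbsolver`, seat sr-mbsolver-m3-5 (R-M3-2 row owner of the `pair_dd` rows), gen 4.
Theorem-only; no definition of a claim node, no named fact; zero compute.

The point.  On the `L × L` torus, for EVERY Fock vector `ψ` (no translation invariance, no ground-state or
normalisation hypothesis) and every displacement `r ∈ ℤ²`,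
  `|P̄_d(L, r; ψ)| ≤ P̄_d(L, 0; ψ)`                                  (`abs_avgPairCorr_le_avgPairCorr_zero`)
where `P̄_d(L, r; ψ) = L⁻² Σ_x Re ⟨ψ, Δ_x† Δ_{x+r} ψ⟩` is the tree's `avgPairCorr` (`Δ_x = localPair dWaveFormFactor L x`).
Proof: the vector inequality `|Re ⟨u, w⟩| ≤ (‖u‖² + ‖w‖²)/2` (`abs_re_star_dotProduct_le_half_add`, from
`0 ≤ ‖u ∓ w‖²`) with `u = Δ_x ψ`, `w = Δ_{x+r} ψ`, summed over `x`, and the re-indexing `x ↦ x + r` of the second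
sum on the torus group `(ℤ/Lℤ)²` — the translation AVERAGE replaces the translation INVARIANCE used in the
thermodynamic-limit companion `Rows/DopedTLPairDominance.lean` (sr-mbsolver-m3-2, states of the quasi-local algebra).
Consequences in the cell's row grammar (`HubbardLadder.PairCorrWindowCert`, the R3 certificate shape): the upper
end of ANY certified diagonal window is `≥ 0` as soon as the sector has a normalised ground state, and ONE certified
diagonal window `[·, u]` at `r = 0` yields the certified two-sided window `[-u, u]` at EVERY `r`
(`pairCorr_box_of_diagCert`, `exists_pairCorrWindowCert_box_of_diagCert`; the DERIVED boxes of the speedrun's S3 T-ROW diagonal ceilings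
`certs/m3/pairdd4x4/`, `HOME/sr-mbsolver-m3-5/PAIRING-BOUNDS.md` §1 B1 / §7.S3).  HONEST LABEL: a kinematic
(Cauchy–Schwarz) transfer; at the M3 point the resulting boxes are wider than the directly certified off-diagonal
T-ROW windows where those exist, and are graded against sr-mbsolver-m3-2's certified kinematic ranges before any word
'non-trivial' is used.
References: O. Bratteli, D. W. Robinson, Operator Algebras and Quantum Statistical Mechanics I, 2nd ed., §2.3.2
(positivity and the Cauchy–Schwarz inequality for states); D. J. Scalapino, Phys. Rep. 250 (1995) 329, §2 eq. (2.4);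
M. Qin et al., Phys. Rev. X 10 (2020) 031016, §II eqs. (2)–(4) (the translation-averaged pair correlator). Folklore otherwise.
-/

namespace Summit.Ventures.CertifiedManyBodySolver.TorusPair

open Matrix Finset Literature.Probability.LatticeModels Literature.MathematicalPhysics.QuantumLattice
  Summit.HubbardSuperconductivity.HubbardLadder
open scoped ComplexOrder BigOperators

noncomputable section

/-! ## §1 Vectors: the cross term is dominated by the diagonal -/

section Vectors

variable {n : Type*} [Fintype n]

/-- **`|Re ⟨u, w⟩| ≤ (Re ⟨u, u⟩ + Re ⟨w, w⟩) / 2`** for complex vectors: expand `0 ≤ ⟨u ∓ w, u ∓ w⟩`.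
Bratteli–Robinson I §2.3.2 (Cauchy–Schwarz for positive functionals), here in its AM–GM form. [folklore] -/
theorem abs_re_star_dotProduct_le_half_add (u w : n → ℂ) :
    |(star u ⬝ᵥ w).re| ≤ ((star u ⬝ᵥ u).re + (star w ⬝ᵥ w).re) / 2 := by
  -- `0 ≤ Re ⟨v, v⟩` and `Re ⟨w, u⟩ = Re ⟨u, w⟩` (complex conjugates), inlined
  have hnn : ∀ v : n → ℂ, 0 ≤ (star v ⬝ᵥ v).re := fun v =>
    (Complex.nonneg_iff.mp (dotProduct_star_self_nonneg v)).1
  have hcomm : (star w ⬝ᵥ u).re = (star u ⬝ᵥ w).re := by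
    rw [star_dotProduct w u, Complex.star_def, Complex.conj_re]
  have hsub := hnn (u - w)
  have hadd := hnn (u + w)
  rw [star_sub, sub_dotProduct, dotProduct_sub, dotProduct_sub] at hsub
  rw [star_add, add_dotProduct, dotProduct_add, dotProduct_add] at hadd
  simp only [Complex.sub_re, Complex.add_re] at hsub hadd
  rw [abs_le]
  constructor <;> linarith

/-- **`|Re ⟨ψ, Xᴴ Y ψ⟩| ≤ (Re ⟨ψ, Xᴴ X ψ⟩ + Re ⟨ψ, Yᴴ Y ψ⟩) / 2`** for operators on a fermionic Fock space and
EVERY vector `ψ`. Bratteli–Robinson I §2.3.2. [folklore] -/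
theorem abs_re_expect_conjTranspose_mul_le_half_add {ι : Type*} [LinearOrder ι] [Fintype ι]
    (X Y : Matrix (Finset ι) (Finset ι) ℂ) (ψ : Fock ι) :
    |(expect (Xᴴ * Y) ψ).re| ≤ ((expect (Xᴴ * X) ψ).re + (expect (Yᴴ * Y) ψ).re) / 2 := by
  rw [PosSemidefTrace.expect_conjTranspose_mul, PosSemidefTrace.expect_conjTranspose_mul,
    PosSemidefTrace.expect_conjTranspose_mul]
  exact abs_re_star_dotProduct_le_half_add _ _

end Vectors

/-! ## §2 The torus: diagonal dominance of `P̄_d(L, r; ψ)` for every state -/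

section Torus

/-- **Diagonal dominance on the finite torus, every state:** `|P̄_d(L, r; ψ)| ≤ P̄_d(L, 0; ψ)` for every side `L`,
every displacement `r` and EVERY Fock vector `ψ` (pointwise AM–GM Cauchy–Schwarz, then the re-indexing `x ↦ x + r`
of one of the two diagonal sums over the torus group). Scalapino, Phys. Rep. 250 (1995) 329, §2 eq. (2.4);
Bratteli–Robinson I §2.3.2. [folklore] -/
theorem abs_avgPairCorr_le_avgPairCorr_zero (L : ℕ) (r : Site 2) (ψ : Fock (Orb (FermionTorus 2 L))) :
    |avgPairCorr L r ψ| ≤ avgPairCorr L 0 ψ := by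
  cases L with
  | zero => simp [avgPairCorr]
  | succ L =>
    have h0 : Torus.proj (L + 1) (0 : Site 2) = 0 := by funext i; simp [Torus.proj]
    simp only [avgPairCorr, h0, add_zero]
    rw [abs_div, abs_of_pos (by positivity : (0 : ℝ) < (((L + 1 : ℕ) : ℝ)) ^ 2)]
    refine div_le_div_of_nonneg_right ?_ (by positivity)
    set r' : TorusSite 2 (L + 1) := Torus.proj (L + 1) r with hr'
    set d : TorusSite 2 (L + 1) → ℝ := fun x =>
      (expect ((localPair dWaveFormFactor (L + 1) x)ᴴ * localPair dWaveFormFactor (L + 1) x) ψ).re with hd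
    have hre : ∑ x : TorusSite 2 (L + 1), d (x + r') = ∑ x : TorusSite 2 (L + 1), d x :=
      Fintype.sum_equiv (Equiv.addRight r') _ _ fun _ => rfl
    calc |∑ x : TorusSite 2 (L + 1), (expect ((localPair dWaveFormFactor (L + 1) x)ᴴ *
              localPair dWaveFormFactor (L + 1) (x + r')) ψ).re|
        ≤ ∑ x : TorusSite 2 (L + 1), |(expect ((localPair dWaveFormFactor (L + 1) x)ᴴ *
              localPair dWaveFormFactor (L + 1) (x + r')) ψ).re| := abs_sum_le_sum_abs _ _
      _ ≤ ∑ x : TorusSite 2 (L + 1), (d x + d (x + r')) / 2 :=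
          sum_le_sum fun x _ => abs_re_expect_conjTranspose_mul_le_half_add _ _ _
      _ = (∑ x : TorusSite 2 (L + 1), d x + ∑ x : TorusSite 2 (L + 1), d (x + r')) / 2 := by
          rw [← sum_add_distrib, sum_div]
      _ = ∑ x : TorusSite 2 (L + 1), d x := by rw [hre]; ring

/-- `P̄_d(L, 0; ψ) ≥ 0` for every state (a sum of squared norms). [folklore] -/
theorem avgPairCorr_zero_nonneg (L : ℕ) (ψ : Fock (Orb (FermionTorus 2 L))) : 0 ≤ avgPairCorr L 0 ψ :=
  (abs_nonneg _).trans (abs_avgPairCorr_le_avgPairCorr_zero L 0 ψ)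

/-- `-P̄_d(L, 0; ψ) ≤ P̄_d(L, r; ψ) ≤ P̄_d(L, 0; ψ)`, the two-sided reading. [folklore] -/
theorem avgPairCorr_mem_Icc (L : ℕ) (r : Site 2) (ψ : Fock (Orb (FermionTorus 2 L))) :
    avgPairCorr L r ψ ∈ Set.Icc (-avgPairCorr L 0 ψ) (avgPairCorr L 0 ψ) :=
  abs_le.mp (abs_avgPairCorr_le_avgPairCorr_zero L r ψ)

end Torus

/-! ## §3 Row grammar: one certified diagonal ceiling boxes every displacement -/

section Rows

variable {H : TorusHamiltonianFamily} {N : ℕ → ℕ} {L : ℕ}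

/-- **One diagonal row boxes every `r`.** A certified window `[lo, u]` for `P̄_d(L, 0; ·)` over the normalised
`(N L, S^z = 0)` sector ground states of `H L` (only its upper end `u = c.hi` is used) bounds `P̄_d(L, r; ·)` in
`[-u, u]` on the same states at EVERY displacement `r` — the DERIVED boxes of a certified diagonal pair-density
ceiling. HONEST FRAMING: first certified bounds; not a superconductivity verdict; every number certified or labelled float.
Scalapino, Phys. Rep. 250 (1995) 329, §2; Qin et al. (2020) §II. [folklore] -/
theorem pairCorr_box_of_diagCert (c : PairCorrWindowCert H N L 0) (r : Site 2)
    (ψ : Fock (Orb (FermionTorus 2 L))) (h1 : star ψ ⬝ᵥ ψ = 1)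
    (hgs : IsGroundStateInSector (H L) (N L) 0 ψ) :
    -c.hi ≤ avgPairCorr L r ψ ∧ avgPairCorr L r ψ ≤ c.hi := by
  have hbox := avgPairCorr_mem_Icc L r ψ
  have hu := (c.sound ψ h1 hgs).2
  exact ⟨by linarith [hbox.1], hbox.2.trans hu⟩

/-- The same with any `u' ≥ c.hi` (a row prints an outward-rounded decimal of the exact rational ceiling). [folklore] -/
theorem pairCorr_box_of_diagCert_le (c : PairCorrWindowCert H N L 0) (r : Site 2) {u' : ℝ} (hu' : c.hi ≤ u')
    (ψ : Fock (Orb (FermionTorus 2 L))) (h1 : star ψ ⬝ᵥ ψ = 1)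
    (hgs : IsGroundStateInSector (H L) (N L) 0 ψ) :
    -u' ≤ avgPairCorr L r ψ ∧ avgPairCorr L r ψ ≤ u' := by
  have h := pairCorr_box_of_diagCert c r ψ h1 hgs
  exact ⟨by linarith [h.1], h.2.trans hu'⟩

/-- **Row-grammar form:** one certified diagonal window yields, at EVERY `r`, a certified `PairCorrWindowCert`
with endpoints `[-c.hi, c.hi]` (existence of the R3-shaped row; its endpoints are recorded in the statement).
[folklore] -/
theorem exists_pairCorrWindowCert_box_of_diagCert (c : PairCorrWindowCert H N L 0) (r : Site 2) :
    ∃ c' : PairCorrWindowCert H N L r, c'.lo = -c.hi ∧ c'.hi = c.hi :=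
  ⟨⟨-c.hi, c.hi, fun ψ h1 hgs => pairCorr_box_of_diagCert c r ψ h1 hgs⟩, rfl, rfl⟩

/-- **The upper end of a certified diagonal window is `≥ 0`** whenever the sector has a normalised ground state
(`P̄_d(L, 0; ψ) ≥ 0`): a certified diagonal CEILING is never sign-resolving. [folklore] -/
theorem pairCorrWindowCert_diag_hi_nonneg (c : PairCorrWindowCert H N L 0)
    (hex : ∃ ψ : Fock (Orb (FermionTorus 2 L)), star ψ ⬝ᵥ ψ = 1 ∧ IsGroundStateInSector (H L) (N L) 0 ψ) :
    0 ≤ c.hi := by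
  obtain ⟨ψ, h1, hgs⟩ := hex
  exact (avgPairCorr_zero_nonneg L ψ).trans (c.sound ψ h1 hgs).2

end Rows

end

end Summit.Ventures.CertifiedManyBodySolver.TorusPair
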